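import Summits.Ventures.HodgeRepro2.T5SexticRecordSatake
import Summits.Ventures.HodgeRepro2.T5CyclotomicInfinitelyManyPlaces

/-!
# A SECOND SEXTIC GALOIS CM FIELD IN KERNEL: `ℚ(ζ₉)` — cyclic, `ℚ(ζ₉)⁺` a cyclic cubic field, the census of its
# places by the order of `p` modulo `9`, infinitely many inert and infinitely many split places

Tier-5 support N3 / §G-N4.2 (seat p3, gen 80). Files 280–282 read the brief's «sextic Galois CM case» for every
sextic Galois CM field; the field of record is `ℚ(ζ₇)`. This file exhibits a SECOND instance of the hypothesis set
(`IsCMField K`, `IsGalois ℚ K`, `[K : ℚ] = 6`) — the hypotheses of files 280–282 are not tailored to `ℚ(ζ₇)` —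
on `K = ℚ(ζ₉)` (`φ(9) = 6`), where Mathlib's `inertiaDeg_eq_of_not_dvd` / `ramificationIdx_eq_of_not_dvd` give
`f(P/p) = orderOf (p mod 9)` and `e(P/p) = 1` for `p ≠ 3`:

* `numberField_nine`, `isCMField_nine`, `isGalois_nine`, `finrank_nine`, **`isCyclic_gal_nine`**,
  `isGalois_maximalRealSubfield_nine`, `finrank_maximalRealSubfield_nine` (`= 3`);
* **`exists_map_eq_iff_even_orderOf_nine`** — a place of `ℚ(ζ₉)⁺` above `p ≠ 3` stays prime in `ℚ(ζ₉)` iff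
  `orderOf (p mod 9)` is even (file 281 + Mathlib), `ncard_primesOver_eq_two_iff_odd_orderOf_nine`;
* the numerals `orderOf_two_zmod_nine` (`= 6`), `orderOf_seventeen_zmod_nine` (`= 2`), `orderOf_seven_zmod_nine`
  (`= 3`), `orderOf_nineteen_zmod_nine` (`= 1`): **`exists_map_eq_two`** (`2` stays prime, `f(v/2) = 3`, `N(v) = 8`),
  **`exists_map_eq_seventeen`** (`17` stays prime, `f(v/17) = 1`, `N(v) = 17`), `ncard_primesOver_eq_two_seven`,
  `ncard_primesOver_eq_two_nineteen` (`7` and `19` split);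
* **`infinite_setOf_staysPrime_nine`**, **`infinite_setOf_ncard_primesOver_eq_two_nine`** — infinitely many places of
  `ℚ(ζ₉)⁺` stay prime (one above each `p ≡ 8 (mod 9)`, Dirichlet) and infinitely many split (`p ≡ 1 (mod 9)`).

The Satake chain at the places above `2` (`q = 8`) and `17` (`q = 17`) is file 284 (`T5CyclotomicNineSatake`).

§8(d): uses an L-value-free non-vanishing device: NO.
-/

open Matrix NumberField NumberField.IsCMField IsDedekindDomain IsDedekindDomain.HeightOneSpectrum Module Polynomial
  MulAction
open scoped TensorProduct Pointwise
open Summit.Ventures.HodgeRepro2.T5UnitaryGroupForm Summit.Ventures.HodgeRepro2.T5UnitaryHeckeAdjoint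
  Summit.Ventures.HodgeRepro2.T5HeckePermutationModule Summit.Ventures.HodgeRepro2.T5HeckeDoubleCoset
  Summit.Ventures.HodgeRepro2.T5RecordHyperspecial Summit.Ventures.HodgeRepro2.T5GlobalLatticeAlmostAll
  Summit.Ventures.HodgeRepro2.T5FinitePlaceSplitClassification Summit.Ventures.HodgeRepro2.T5RecordSatakeIntrinsic
  Summit.Ventures.HodgeRepro2.T5CMFieldSquareDatum Summit.Ventures.HodgeRepro2.T5RecordSatakeToy
  Summit.Ventures.HodgeRepro2.T5SplitPlaceUnitaryGroup Summit.Ventures.HodgeRepro2.T5NonSplitPlaceUnitaryGroup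
  Summit.Ventures.HodgeRepro2.T5FinitePlaceCM Summit.Ventures.HodgeRepro2.T5StarOfInvolution
  Summit.Ventures.HodgeRepro2.T5RecordSatake Summit.Ventures.HodgeRepro2.T5RecordSatakeInert
  Summit.Ventures.HodgeRepro2.T5RecordSatakeInertToyDegree Summit.Ventures.HodgeRepro2.T5RecordSatakeDegreeCells
  Summit.Ventures.HodgeRepro2.T5CyclotomicSevenHeckeCommutative
  Summit.Ventures.HodgeRepro2.T5CMFieldCyclicGaloisCriterion Summit.Ventures.HodgeRepro2.T5SexticRecordSatake

namespace Summit.Ventures.HodgeRepro2.T5CyclotomicNineSextic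

section Field

variable (K : Type*) [Field K] [CharZero K] [IsCyclotomicExtension {9} ℚ K]

/-- `ℚ(ζ₉)` is a number field. -/
theorem numberField_nine : NumberField K := IsCyclotomicExtension.numberField {9} ℚ K

/-- `ℚ(ζ₉)` is a CM field (Mathlib's `IsCyclotomicExtension.Rat.isCMField`, `9 > 2`). -/
theorem isCMField_nine : IsCMField K := IsCyclotomicExtension.Rat.isCMField K (S := {9}) ⟨9, rfl, by norm_num⟩

/-- `ℚ(ζ₉)/ℚ` is Galois. -/
theorem isGalois_nine : IsGalois ℚ K := IsCyclotomicExtension.isGalois {9} ℚ K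

/-- `φ(9) = 6`. -/
theorem totient_nine : Nat.totient 9 = 6 := by decide

/-- **`[ℚ(ζ₉) : ℚ] = 6`**. -/
theorem finrank_nine : Module.finrank ℚ K = 6 := by
  haveI : NeZero (9 : ℕ) := ⟨by norm_num⟩
  rw [IsCyclotomicExtension.Rat.finrank 9 K, totient_nine]

/-- **`Gal(ℚ(ζ₉)/ℚ)` is cyclic** — here by file 280 (a sextic Galois CM field), with no use of `(ℤ/9)ˣ`. -/
theorem isCyclic_gal_nine : IsCyclic (K ≃ₐ[ℚ] K) :=
  haveI := numberField_nine K
  haveI := isCMField_nine K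
  haveI := isGalois_nine K
  T5CMFieldCyclicGaloisCriterion.isCyclic_gal K (finrank_nine K)

/-- **`ℚ(ζ₉)⁺/ℚ` is Galois** (file 281). -/
theorem isGalois_maximalRealSubfield_nine :
    haveI := numberField_nine K; haveI := isCMField_nine K
    IsGalois ℚ (maximalRealSubfield K) :=
  haveI := numberField_nine K
  haveI := isCMField_nine K
  haveI := isGalois_nine K
  T5CMFieldCyclicGaloisCriterion.isGalois_maximalRealSubfield K (finrank_nine K)

/-- **`[ℚ(ζ₉)⁺ : ℚ] = 3`** (file 281). -/
theorem finrank_maximalRealSubfield_nine :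
    haveI := numberField_nine K; haveI := isCMField_nine K
    Module.finrank ℚ (maximalRealSubfield K) = 3 :=
  haveI := numberField_nine K
  haveI := isCMField_nine K
  haveI := isGalois_nine K
  T5CMFieldCyclicGaloisCriterion.finrank_maximalRealSubfield K (finrank_nine K)

end Field

section Census

variable (K : Type*) [Field K] [CharZero K] [IsCyclotomicExtension {9} ℚ K]
variable (p : ℕ) [hp : Fact p.Prime] (hn : ¬ p ∣ 9)
variable (P : Ideal (𝓞 K)) [hP : P.IsPrime] [hPp : P.LiesOver (Ideal.span {(p : ℤ)})]
variable (v : HeightOneSpectrum (𝓞 (maximalRealSubfield K))) [hPv : P.LiesOver v.asIdeal]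

include hn in
/-- `e(P/p) = 1` for `p ≠ 3` (Mathlib). -/
theorem ramificationIdx_eq_one_nine :
    haveI := numberField_nine K
    P.ramificationIdx ℤ = 1 :=
  haveI := numberField_nine K
  IsCyclotomicExtension.Rat.ramificationIdx_eq_of_not_dvd (m := 9) p K P hn

include hn in
/-- `f(P/p) = orderOf (p mod 9)` for `p ≠ 3` (Mathlib). -/
theorem inertiaDeg_eq_orderOf_nine :
    haveI := numberField_nine K
    P.inertiaDeg ℤ = orderOf (p : ZMod 9) :=
  haveI := numberField_nine K
  IsCyclotomicExtension.Rat.inertiaDeg_eq_of_not_dvd (m := 9) p K P hn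

include hn hPv in
/-- **A place of `ℚ(ζ₉)⁺` above `p ≠ 3` stays prime in `ℚ(ζ₉)` iff `orderOf (p mod 9)` is even** (file 281's
criterion with Mathlib's inertia degree). -/
theorem exists_map_eq_iff_even_orderOf_nine :
    haveI := numberField_nine K; haveI := isCMField_nine K
    (∃ w : HeightOneSpectrum (𝓞 K),
      Ideal.map (algebraMap (𝓞 (maximalRealSubfield K)) (𝓞 K)) v.asIdeal = w.asIdeal) ↔
      Even (orderOf (p : ZMod 9)) := by
  haveI := numberField_nine K
  haveI := isCMField_nine K
  haveI := isGalois_nine K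
  rw [T5CMFieldCyclicGaloisCriterion.exists_map_eq_iff_even_inertiaDeg_sextic K (finrank_nine K) p P v
    (ramificationIdx_eq_one_nine K p hn P), inertiaDeg_eq_orderOf_nine K p hn P]

include hn hPv in
/-- **Two places of `ℚ(ζ₉)` above `v` iff `orderOf (p mod 9)` is odd.** -/
theorem ncard_primesOver_eq_two_iff_odd_orderOf_nine :
    haveI := numberField_nine K; haveI := isCMField_nine K
    (v.asIdeal.primesOver (𝓞 K)).ncard = 2 ↔ Odd (orderOf (p : ZMod 9)) := by
  haveI := numberField_nine K
  haveI := isCMField_nine K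
  haveI := isGalois_nine K
  haveI := T5CMFieldCyclicGaloisCriterion.isCyclic_gal K (finrank_nine K)
  rw [T5CMFieldCyclicGaloisCriterion.ncard_primesOver_eq_two_iff_odd_inertiaDeg K p P v
    (ramificationIdx_eq_one_nine K p hn P), inertiaDeg_eq_orderOf_nine K p hn P]

end Census

section Numerals

/-- `2` has order `6` modulo `9`. -/
theorem orderOf_two_zmod_nine : orderOf ((2 : ℕ) : ZMod 9) = 6 := by
  rw [Nat.cast_ofNat, orderOf_eq_iff (by norm_num)]
  decide

/-- `17 ≡ 8 ≡ −1` has order `2` modulo `9`. -/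
theorem orderOf_seventeen_zmod_nine : orderOf ((17 : ℕ) : ZMod 9) = 2 := by
  rw [Nat.cast_ofNat, orderOf_eq_iff (by norm_num)]
  decide

/-- `7` has order `3` modulo `9`. -/
theorem orderOf_seven_zmod_nine : orderOf ((7 : ℕ) : ZMod 9) = 3 := by
  rw [Nat.cast_ofNat, orderOf_eq_iff (by norm_num)]
  decide

/-- `19 ≡ 1` has order `1` modulo `9`. -/
theorem orderOf_nineteen_zmod_nine : orderOf ((19 : ℕ) : ZMod 9) = 1 := by
  rw [Nat.cast_ofNat, orderOf_eq_iff (by norm_num)]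
  decide

variable (K : Type*) [Field K] [CharZero K] [IsCyclotomicExtension {9} ℚ K]

/-- **`2` STAYS PRIME**: every place of `ℚ(ζ₉)⁺` above `2` has one prime of `ℚ(ζ₉)` above it (`orderOf 2 = 6`
even), with `f(v/2) = 3` and `N(v) = 8`. -/
theorem exists_map_eq_two (P : Ideal (𝓞 K)) [hP : P.IsPrime] [hPp : P.LiesOver (Ideal.span {(2 : ℤ)})]
    (v : HeightOneSpectrum (𝓞 (maximalRealSubfield K))) [hPv : P.LiesOver v.asIdeal] :
    haveI := numberField_nine K; haveI := isCMField_nine K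
    (∃ w : HeightOneSpectrum (𝓞 K),
      Ideal.map (algebraMap (𝓞 (maximalRealSubfield K)) (𝓞 K)) v.asIdeal = w.asIdeal) ∧
      v.asIdeal.inertiaDeg ℤ = 3 ∧ Ideal.absNorm v.asIdeal = 8 := by
  haveI := numberField_nine K
  haveI := isCMField_nine K
  haveI := isGalois_nine K
  haveI : Fact (Nat.Prime 2) := ⟨Nat.prime_two⟩
  haveI := T5CMFieldCyclicGaloisCriterion.isCyclic_gal K (finrank_nine K)
  have hn : ¬ (2 : ℕ) ∣ 9 := by norm_num
  have he := ramificationIdx_eq_one_nine K 2 hn P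
  have hf : P.inertiaDeg ℤ = 6 := by rw [inertiaDeg_eq_orderOf_nine K 2 hn P, orderOf_two_zmod_nine]
  have h1 : (v.asIdeal.primesOver (𝓞 K)).ncard = 1 :=
    (T5CMFieldCyclicGaloisCriterion.ncard_primesOver_eq_one_iff_even_inertiaDeg K 2 P v he).mpr
      (by rw [hf]; decide)
  have hv2 := T5SexticRecordSatake.inertiaDeg_eq_two_mul_of_ncard_eq_one K v P he h1
  rw [hf] at hv2
  refine ⟨(exists_map_eq_iff_even_orderOf_nine K 2 hn P v).mpr (by rw [orderOf_two_zmod_nine]; decide),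
    by omega, ?_⟩
  haveI : v.asIdeal.LiesOver (Ideal.span {(2 : ℤ)}) := Ideal.LiesOver.tower_bot P v.asIdeal _
  rw [T5SexticRecordSatake.absNorm_eq_pow_inertiaDeg K 2 v, show v.asIdeal.inertiaDeg ℤ = 3 by omega]
  norm_num

/-- **`17` STAYS PRIME**: every place of `ℚ(ζ₉)⁺` above `17` has one prime of `ℚ(ζ₉)` above it (`orderOf 17 = 2`
even), with `f(v/17) = 1` and `N(v) = 17` — a degree-one inert place. -/
theorem exists_map_eq_seventeen (P : Ideal (𝓞 K)) [hP : P.IsPrime] [hPp : P.LiesOver (Ideal.span {(17 : ℤ)})]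
    (v : HeightOneSpectrum (𝓞 (maximalRealSubfield K))) [hPv : P.LiesOver v.asIdeal] :
    haveI := numberField_nine K; haveI := isCMField_nine K
    (∃ w : HeightOneSpectrum (𝓞 K),
      Ideal.map (algebraMap (𝓞 (maximalRealSubfield K)) (𝓞 K)) v.asIdeal = w.asIdeal) ∧
      v.asIdeal.inertiaDeg ℤ = 1 ∧ Ideal.absNorm v.asIdeal = 17 := by
  haveI := numberField_nine K
  haveI := isCMField_nine K
  haveI := isGalois_nine K
  haveI : Fact (Nat.Prime 17) := ⟨by norm_num⟩
  haveI := T5CMFieldCyclicGaloisCriterion.isCyclic_gal K (finrank_nine K)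
  have hn : ¬ (17 : ℕ) ∣ 9 := by norm_num
  have he := ramificationIdx_eq_one_nine K 17 hn P
  have hf : P.inertiaDeg ℤ = 2 := by rw [inertiaDeg_eq_orderOf_nine K 17 hn P, orderOf_seventeen_zmod_nine]
  have h1 : (v.asIdeal.primesOver (𝓞 K)).ncard = 1 :=
    (T5CMFieldCyclicGaloisCriterion.ncard_primesOver_eq_one_iff_even_inertiaDeg K 17 P v he).mpr
      (by rw [hf]; decide)
  have hv2 := T5SexticRecordSatake.inertiaDeg_eq_two_mul_of_ncard_eq_one K v P he h1
  rw [hf] at hv2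
  refine ⟨(exists_map_eq_iff_even_orderOf_nine K 17 hn P v).mpr (by rw [orderOf_seventeen_zmod_nine]; decide),
    by omega, ?_⟩
  haveI : v.asIdeal.LiesOver (Ideal.span {(17 : ℤ)}) := Ideal.LiesOver.tower_bot P v.asIdeal _
  rw [T5SexticRecordSatake.absNorm_eq_pow_inertiaDeg K 17 v, show v.asIdeal.inertiaDeg ℤ = 1 by omega]
  norm_num

/-- **`7` SPLITS**: two places of `ℚ(ζ₉)` above every place of `ℚ(ζ₉)⁺` above `7` (`orderOf 7 = 3` odd). -/
theorem ncard_primesOver_eq_two_seven (P : Ideal (𝓞 K)) [hP : P.IsPrime] [hPp : P.LiesOver (Ideal.span {(7 : ℤ)})]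
    (v : HeightOneSpectrum (𝓞 (maximalRealSubfield K))) [hPv : P.LiesOver v.asIdeal] :
    haveI := numberField_nine K; haveI := isCMField_nine K
    (v.asIdeal.primesOver (𝓞 K)).ncard = 2 := by
  haveI := numberField_nine K
  haveI := isCMField_nine K
  haveI : Fact (Nat.Prime 7) := ⟨by norm_num⟩
  exact (ncard_primesOver_eq_two_iff_odd_orderOf_nine K 7 (by norm_num) P v).mpr
    (by rw [orderOf_seven_zmod_nine]; decide)

/-- **`19` SPLITS**: two places of `ℚ(ζ₉)` above every place of `ℚ(ζ₉)⁺` above `19` (`orderOf 19 = 1` odd). -/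
theorem ncard_primesOver_eq_two_nineteen (P : Ideal (𝓞 K)) [hP : P.IsPrime]
    [hPp : P.LiesOver (Ideal.span {(19 : ℤ)})]
    (v : HeightOneSpectrum (𝓞 (maximalRealSubfield K))) [hPv : P.LiesOver v.asIdeal] :
    haveI := numberField_nine K; haveI := isCMField_nine K
    (v.asIdeal.primesOver (𝓞 K)).ncard = 2 := by
  haveI := numberField_nine K
  haveI := isCMField_nine K
  haveI : Fact (Nat.Prime 19) := ⟨by norm_num⟩
  exact (ncard_primesOver_eq_two_iff_odd_orderOf_nine K 19 (by norm_num) P v).mpr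
    (by rw [orderOf_nineteen_zmod_nine]; decide)

end Numerals
section Infinitude

/-- `8 ≡ −1` has order `2` modulo `9`. -/
theorem orderOf_eight_zmod_nine : orderOf ((8 : ℕ) : ZMod 9) = 2 := by
  rw [Nat.cast_ofNat, orderOf_eq_iff (by norm_num)]
  decide

/-- `1` has order `1` modulo `9`. -/
theorem orderOf_one_zmod_nine : orderOf ((1 : ℕ) : ZMod 9) = 1 := by
  rw [Nat.cast_one, orderOf_one]

/-- **Infinitely many primes `p ≡ 8 (mod 9)`** (Dirichlet, Mathlib's `Nat.infinite_setOf_prime_and_eq_mod`). -/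
theorem infinite_setOf_prime_and_eq_eight : {p : ℕ | p.Prime ∧ (p : ZMod 9) = ((8 : ℕ) : ZMod 9)}.Infinite :=
  Nat.infinite_setOf_prime_and_eq_mod ((ZMod.isUnit_iff_coprime 8 9).mpr (by norm_num))

/-- **Infinitely many primes `p ≡ 1 (mod 9)`.** -/
theorem infinite_setOf_prime_and_eq_one : {p : ℕ | p.Prime ∧ (p : ZMod 9) = ((1 : ℕ) : ZMod 9)}.Infinite :=
  Nat.infinite_setOf_prime_and_eq_mod ((ZMod.isUnit_iff_coprime 1 9).mpr (by norm_num))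

variable (K : Type*) [Field K] [CharZero K] [IsCyclotomicExtension {9} ℚ K]

/-- **Infinitely many places of `ℚ(ζ₉)⁺` stay prime in `ℚ(ζ₉)`** — one above each prime `p ≡ 8 (mod 9)` (order `2`:
degree-one inert places, `q = p`); file 274's chosen place `placeAboveCyc` is injective in `p`. -/
theorem infinite_setOf_staysPrime_nine :
    haveI := numberField_nine K
    {v : HeightOneSpectrum (𝓞 (maximalRealSubfield K)) | ∃ w : HeightOneSpectrum (𝓞 K),
      Ideal.map (algebraMap (𝓞 (maximalRealSubfield K)) (𝓞 K)) v.asIdeal = w.asIdeal}.Infinite := by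
  haveI := numberField_nine K
  haveI := isCMField_nine K
  haveI : Infinite {p : ℕ // p.Prime ∧ (p : ZMod 9) = ((8 : ℕ) : ZMod 9)} :=
    infinite_setOf_prime_and_eq_eight.to_subtype
  refine Set.infinite_of_injective_forall_mem
    (f := fun p : {p : ℕ // p.Prime ∧ (p : ZMod 9) = ((8 : ℕ) : ZMod 9)} =>
      haveI : Fact p.1.Prime := ⟨p.2.1⟩
      T5CyclotomicInfinitelyManyPlaces.placeAboveCyc K p.1) ?_ ?_
  · intro p q h
    exact Subtype.ext (T5CyclotomicInfinitelyManyPlaces.placeAboveCyc_injective_of_prime K p.2.1 q.2.1 h)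
  · intro p
    haveI : Fact p.1.Prime := ⟨p.2.1⟩
    haveI := T5CyclotomicInfinitelyManyPlaces.liesOver_placeAboveCyc K p.1
    obtain ⟨⟨P, hP, hPo⟩⟩ :=
      Ideal.nonempty_primesOver (S := 𝓞 K) (T5CyclotomicInfinitelyManyPlaces.placeAboveCyc K p.1).asIdeal
    haveI := hP
    haveI := hPo
    haveI : P.LiesOver (Ideal.span {(p.1 : ℤ)}) :=
      Ideal.LiesOver.trans P (T5CyclotomicInfinitelyManyPlaces.placeAboveCyc K p.1).asIdeal _
    have hn : ¬ p.1 ∣ 9 := p.2.1.coprime_iff_not_dvd.mp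
      ((ZMod.isUnit_iff_coprime p.1 9).mp (by rw [p.2.2]; exact (ZMod.isUnit_iff_coprime 8 9).mpr (by norm_num)))
    exact (exists_map_eq_iff_even_orderOf_nine K p.1 hn P
      (T5CyclotomicInfinitelyManyPlaces.placeAboveCyc K p.1)).mpr (by rw [p.2.2, orderOf_eight_zmod_nine]; exact even_two)

/-- **Infinitely many places of `ℚ(ζ₉)⁺` have two places of `ℚ(ζ₉)` above them** — one above each prime
`p ≡ 1 (mod 9)` (order `1`). -/
theorem infinite_setOf_ncard_primesOver_eq_two_nine :
    haveI := numberField_nine K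
    {v : HeightOneSpectrum (𝓞 (maximalRealSubfield K)) | (v.asIdeal.primesOver (𝓞 K)).ncard = 2}.Infinite := by
  haveI := numberField_nine K
  haveI := isCMField_nine K
  haveI : Infinite {p : ℕ // p.Prime ∧ (p : ZMod 9) = ((1 : ℕ) : ZMod 9)} :=
    infinite_setOf_prime_and_eq_one.to_subtype
  refine Set.infinite_of_injective_forall_mem
    (f := fun p : {p : ℕ // p.Prime ∧ (p : ZMod 9) = ((1 : ℕ) : ZMod 9)} =>
      haveI : Fact p.1.Prime := ⟨p.2.1⟩
      T5CyclotomicInfinitelyManyPlaces.placeAboveCyc K p.1) ?_ ?_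
  · intro p q h
    exact Subtype.ext (T5CyclotomicInfinitelyManyPlaces.placeAboveCyc_injective_of_prime K p.2.1 q.2.1 h)
  · intro p
    haveI : Fact p.1.Prime := ⟨p.2.1⟩
    haveI := T5CyclotomicInfinitelyManyPlaces.liesOver_placeAboveCyc K p.1
    obtain ⟨⟨P, hP, hPo⟩⟩ :=
      Ideal.nonempty_primesOver (S := 𝓞 K) (T5CyclotomicInfinitelyManyPlaces.placeAboveCyc K p.1).asIdeal
    haveI := hP
    haveI := hPo
    haveI : P.LiesOver (Ideal.span {(p.1 : ℤ)}) :=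
      Ideal.LiesOver.trans P (T5CyclotomicInfinitelyManyPlaces.placeAboveCyc K p.1).asIdeal _
    have hn : ¬ p.1 ∣ 9 := p.2.1.coprime_iff_not_dvd.mp
      ((ZMod.isUnit_iff_coprime p.1 9).mp (by rw [p.2.2]; exact (ZMod.isUnit_iff_coprime 1 9).mpr (by norm_num)))
    exact (ncard_primesOver_eq_two_iff_odd_orderOf_nine K p.1 hn P
      (T5CyclotomicInfinitelyManyPlaces.placeAboveCyc K p.1)).mpr (by rw [p.2.2, orderOf_one_zmod_nine]; exact odd_one)

end Infinitude

end Summit.Ventures.HodgeRepro2.T5CyclotomicNineSextic
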